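import Mathlib
import Summits.KontsevichZagierPeriods.KontsevichZagierPeriods.Theses.InverseLandau

/-!
# `TateLifting`, line `Sketch`, stub `stub_logIntegral` — the logarithm as a cube period

Crux stmt-KontsevichZagierPeriods-9129
(`Summit.KontsevichZagierPeriods.KontsevichZagierPeriods.Theses.InverseLandau.TateLifting`),
weight-one sector. The Tate unfolding of the logarithm over the open unit `1`-cube:
`∫_{(0,1)} (x − 1) dz₀ / (1 + (x − 1) z₀) = log x` for `x > 0` (primitive
`log (1 + (x−1) z₀)`, whose argument is positive on `[0,1]` since `1 + (x−1)z₀` lies between `1`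
and `x`). The integral is over the cube
`Set.pi univ (fun _ : Fin 1 => Ioo 0 1)` of `Fin 1 → ℝ`, as in the crux (reduce to an interval
integral with `MeasureTheory.volume_preserving_funUnique` / `MeasurableEquiv.funUnique`).
-/

noncomputable section

namespace Summit.KontsevichZagierPeriods.InverseLandau

open Literature.NumberTheory.Transcendental
open MeasureTheory

/-- Positivity of the affine denominator: `0 < 1 + c t` for `-1 < c` and `t ∈ [0,1]`, since
`1 + c t` lies between `1` and `1 + c`. [folklore] -/
theorem tateLifting_logIntegral_one_add_mul_pos {c : ℝ} (hc : -1 < c) {t : ℝ}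
    (ht : t ∈ Set.uIcc (0 : ℝ) 1) : 0 < 1 + c * t := by
  rw [Set.uIcc_of_le zero_le_one] at ht
  rcases le_or_gt 0 c with hc0 | hc0
  · nlinarith [ht.1]
  · have := mul_le_mul_of_nonpos_left ht.2 hc0.le
    linarith

/-- The one-variable logarithm integral `∫₀¹ c dt/(1 + c t) = log (1 + c)` for `-1 < c`
(primitive `t ↦ log (1 + c t)`). [folklore] -/
theorem tateLifting_logIntegral_interval {c : ℝ} (hc : -1 < c) :
    ∫ t in (0 : ℝ)..1, c / (1 + c * t) = Real.log (1 + c) := by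
  have hpos : ∀ t ∈ Set.uIcc (0 : ℝ) 1, 0 < 1 + c * t := fun t ht =>
    tateLifting_logIntegral_one_add_mul_pos hc ht
  have hderiv : ∀ t ∈ Set.uIcc (0 : ℝ) 1,
      HasDerivAt (fun t => Real.log (1 + c * t)) (c / (1 + c * t)) t := by
    intro t ht
    have h1 : HasDerivAt (fun t : ℝ => 1 + c * t) c t := by
      simpa using ((hasDerivAt_id t).const_mul c).const_add 1
    convert h1.log (hpos t ht).ne' using 1
  have hcont : ContinuousOn (fun t : ℝ => c / (1 + c * t)) (Set.Icc 0 1) :=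
    continuousOn_const.div (by fun_prop) fun t ht =>
      (hpos t (by rwa [Set.uIcc_of_le zero_le_one])).ne'
  rw [intervalIntegral.integral_eq_sub_of_hasDerivAt hderiv
    (hcont.intervalIntegrable_of_Icc zero_le_one)]
  simp

/-- The open unit cube of `Fin 1 → ℝ` is the preimage of `(0,1)` under evaluation at the unique
coordinate (the measurable equivalence `MeasurableEquiv.funUnique`). [folklore] -/
theorem tateLifting_logIntegral_cube_eq_preimage :
    Set.pi Set.univ (fun _ : Fin 1 => Set.Ioo (0 : ℝ) 1) =
      (MeasurableEquiv.funUnique (Fin 1) ℝ) ⁻¹' Set.Ioo (0 : ℝ) 1 := by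
  ext z
  rw [Set.mem_univ_pi, Fin.forall_fin_one, Set.mem_preimage]
  exact Iff.rfl

/-- **The logarithm as a Tate cube period** (stub `stub_logIntegral` of line `Sketch` for crux
`TateLifting`): `∫_{(0,1)¹} (x − 1)/(1 + (x − 1) z₀) dz = log x` for `x > 0`. [folklore] -/
theorem tateLifting_logIntegral :
    ∀ x : ℝ, 0 < x →
      ∫ z in Set.pi Set.univ (fun _ : Fin 1 => Set.Ioo (0 : ℝ) 1),
        (x - 1) / (1 + (x - 1) * z 0) = Real.log x := by
  intro x hx
  have h := (volume_preserving_funUnique (Fin 1) ℝ).setIntegral_preimage_emb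
      (MeasurableEquiv.measurableEmbedding _) (fun t : ℝ => (x - 1) / (1 + (x - 1) * t))
      (Set.Ioo (0 : ℝ) 1)
  have key : ∫ t in (0 : ℝ)..1, (x - 1) / (1 + (x - 1) * t) = Real.log x := by
    have hx1 : (-1 : ℝ) < x - 1 := by linarith
    have e : (1 : ℝ) + (x - 1) = x := by ring
    have := tateLifting_logIntegral_interval hx1
    rwa [e] at this
  rw [intervalIntegral.integral_of_le zero_le_one, integral_Ioc_eq_integral_Ioo] at key
  rw [tateLifting_logIntegral_cube_eq_preimage]
  exact h.trans key

end Summit.KontsevichZagierPeriods.InverseLandau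

end
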